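import Mathlib.Analysis.FunctionalSpaces.SobolevInequality
import Mathlib.MeasureTheory.Function.LpSpace.Complete
import Literature.Analysis.FluidPDE.WholeSpaceIBP
import HarnessLib

/-!
# The Gagliardo–Nirenberg–Sobolev inequality on the whole space without compact support

Analysis/FluidPDE support file (serves the discharge of `Literature.Analysis.FluidPDE.tao2011_velocity_eq_of_memSobolevX`,
Tao 2011, Cor. 4.3 + Thm. 5.4 (iii), where the Sobolev embedding `H¹(ℝ³) ⊂ L⁶(ℝ³)` controls the
nonlinear term).

Let `E` be a finite-dimensional real inner product space of dimension `n`, `μ` an additive Haar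
measure on `E`, `F` a finite-dimensional real normed space, `1 ≤ p < n` and `p'⁻¹ = p⁻¹ - n⁻¹`.
Mathlib proves the Gagliardo–Nirenberg–Sobolev inequality
`‖u‖_{L^{p'}} ≤ C ‖Du‖_{L^p}` for `u ∈ C¹_c(E; F)` (`MeasureTheory.eLpNorm_le_eLpNorm_fderiv_of_eq`).
Here we remove the compact-support hypothesis: the same inequality, **with the same constant**,
holds for every `C¹` function `u` with `u ∈ L^p` (any decay ruling out the constants would do; `L^p`
is what the energy class provides) — in particular for `u ∈ H¹(ℝ³)`, `‖u‖_{L⁶} ≤ C ‖∇u‖_{L²}`.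

Proof (Evans, *PDE*, §5.6.1, proof of Thm. 2, truncation instead of density): with the smooth
cut-offs `χ_R = Fluid.cutoff R` (`= 1` on `B_R`, supported in `B_{2R}`, `‖Dχ_R‖ ≤ C/R`;
`WholeSpaceIBP`), `u_R = χ_R u ∈ C¹_c`, `‖D u_R‖_p ≤ ‖Du‖_p + (C/R) ‖u‖_p`, so Mathlib's inequality
gives `‖u_R‖_{p'} ≤ K (‖Du‖_p + (C/R)‖u‖_p)`; as `R → ∞`, `u_R → u` pointwise and Fatou's lemma in
`L^{p'}` (`MeasureTheory.Lp.eLpNorm_lim_le_liminf_eLpNorm`) gives `‖u‖_{p'} ≤ K ‖Du‖_p`.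

## Mathlib search

Mathlib (this pin) has the `C¹_c` inequality (`eLpNorm_le_eLpNorm_fderiv_of_eq`, constant
`SNormLESNormFDerivOfEqConst`) and the bounded-support variants `eLpNorm_le_eLpNorm_fderiv_of_le`,
`eLpNorm_le_eLpNorm_fderiv`; it has no version for non-compactly-supported functions (searched
`SobolevInequality.lean`: every statement assumes `HasCompactSupport` or `support ⊆ s` bounded). The
tree's `Literature.Analysis.FunctionSpaces.gagliardo_nirenberg_sobolev` (`FunctionSpaces/SobolevDomain`) is the `W₀^{1,p}(Ω)` form
(closure class, unproved fact); the smooth whole-space form below is what classical solutions need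
and is proved.

## References

* L. C. Evans, *Partial Differential Equations*, 2nd ed. (2010), §5.6.1, Thm. 1 (GNS for `C¹_c`)
  and Thm. 2 (extension to `W^{1,p}`), §5.6.3.
* T. Tao, *Localisation and compactness properties of the Navier–Stokes global regularity
  problem*, Anal. PDE 6 (2013) = arXiv:1108.1165, §2 (Sobolev embedding used throughout).
-/

noncomputable section

open MeasureTheory Filter Topology Set Function Module
open scoped ENNReal NNReal

namespace Literature.Analysis.FluidPDE

variable {E : Type*} [NormedAddCommGroup E] [InnerProductSpace ℝ E] [FiniteDimensional ℝ E]
  [MeasurableSpace E] [BorelSpace E]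
variable {F : Type*} [NormedAddCommGroup F] [NormedSpace ℝ F]

omit [FiniteDimensional ℝ E] [MeasurableSpace E] [BorelSpace E] in
/-- Derivative of a truncation: `‖D(χ_R u)(x)‖ ≤ ‖Du(x)‖ + (C/R) ‖u(x)‖` when `‖Dχ_R‖ ≤ C/R`
(`|χ_R| ≤ 1`; Leibniz rule) — the truncation step of Evans's proof of the `W^{1,p}` extension.
[cite: Evans2010, §5.6.1 proof of Thm. 2] -/
theorem SobolevWholeSpace.norm_fderiv_cutoff_smul_le {u : E → F} (hu : ContDiff ℝ 1 u) {C R : ℝ}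
    (hC : ∀ x : E, ‖fderiv ℝ (cutoff R) x‖ ≤ C / R) (x : E) :
    ‖fderiv ℝ (fun y => cutoff R y • u y) x‖ ≤ ‖fderiv ℝ u x‖ + C / R * ‖u x‖ := by
  have hχ : DifferentiableAt ℝ (cutoff (E := E) R) x :=
    ((contDiff_cutoff (n := 1) R).differentiable one_ne_zero) x
  have hux : DifferentiableAt ℝ u x := (hu.differentiable one_ne_zero) x
  rw [fderiv_fun_smul hχ hux]
  calc ‖cutoff R x • fderiv ℝ u x + (fderiv ℝ (cutoff R) x).smulRight (u x)‖
      ≤ ‖cutoff R x • fderiv ℝ u x‖ + ‖(fderiv ℝ (cutoff R) x).smulRight (u x)‖ :=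
        norm_add_le _ _
    _ ≤ ‖fderiv ℝ u x‖ + C / R * ‖u x‖ := by
        gcongr
        · rw [norm_smul, Real.norm_eq_abs]
          exact mul_le_of_le_one_left (norm_nonneg _) (abs_cutoff_le_one R x)
        · rw [ContinuousLinearMap.norm_smulRight_apply]
          exact mul_le_mul_of_nonneg_right (hC x) (norm_nonneg _)

omit [FiniteDimensional ℝ E] in
/-- `L^p` bound for the derivative of a truncation:
`‖D(χ_R u)‖_{L^p} ≤ ‖Du‖_{L^p} + (C/R) ‖u‖_{L^p}` (`1 ≤ p`, `0 ≤ C`) — the truncation step of Evans's proof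
of the `W^{1,p}` extension, in `L^p`. [cite: Evans2010, §5.6.1 proof of Thm. 2] -/
theorem eLpNorm_fderiv_cutoff_smul_le (μ : Measure E) {u : E → F} (hu : ContDiff ℝ 1 u)
    {C R : ℝ} (hC0 : 0 ≤ C) (hR : 0 < R) (hC : ∀ x : E, ‖fderiv ℝ (cutoff R) x‖ ≤ C / R)
    {p : ℝ≥0∞} (hp : 1 ≤ p) :
    eLpNorm (fderiv ℝ fun y => cutoff R y • u y) p μ ≤
      eLpNorm (fderiv ℝ u) p μ + ENNReal.ofReal (C / R) * eLpNorm u p μ := by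
  have hmeas₁ : AEStronglyMeasurable (fun x => ‖fderiv ℝ u x‖) μ :=
    (hu.continuous_fderiv one_ne_zero).norm.aestronglyMeasurable
  have hmeas₂ : AEStronglyMeasurable (fun x => C / R * ‖u x‖) μ :=
    (continuous_const.mul hu.continuous.norm).aestronglyMeasurable
  calc eLpNorm (fderiv ℝ fun y => cutoff R y • u y) p μ
      ≤ eLpNorm (fun x => ‖fderiv ℝ u x‖ + C / R * ‖u x‖) p μ :=
        eLpNorm_mono_real (SobolevWholeSpace.norm_fderiv_cutoff_smul_le hu hC)
    _ ≤ eLpNorm (fun x => ‖fderiv ℝ u x‖) p μ + eLpNorm (fun x => C / R * ‖u x‖) p μ :=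
        eLpNorm_add_le hmeas₁ hmeas₂ hp
    _ = eLpNorm (fderiv ℝ u) p μ + ENNReal.ofReal (C / R) * eLpNorm u p μ := by
        rw [eLpNorm_norm]
        congr 1
        have : (fun x => C / R * ‖u x‖) = (C / R) • fun x => ‖u x‖ := rfl
        rw [this, eLpNorm_const_smul, eLpNorm_norm, Real.enorm_eq_ofReal (by positivity)]

variable [FiniteDimensional ℝ F]

/-- **Gagliardo–Nirenberg–Sobolev inequality without compact support.** Let `E` have dimension
`n ≥ 1`, `μ` be an additive Haar measure on `E`, `1 ≤ p`, `p'⁻¹ = p⁻¹ - n⁻¹`, and let `u : E → F`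
be `C¹` with `‖u‖_{L^p(μ)} < ∞`. Then `‖u‖_{L^{p'}(μ)} ≤ K ‖Du‖_{L^p(μ)}` with the same constant
`K = SNormLESNormFDerivOfEqConst F μ p` as Mathlib's compactly supported case (Evans, *PDE*, §5.6.1,
Thm. 1 with the truncation argument of Thm. 2; the hypothesis `u ∈ L^p` only serves to exclude
the constants). [cite: Evans2010, §5.6.1 Thm. 1–2] -/
theorem eLpNorm_le_eLpNorm_fderiv_of_eq_of_eLpNorm_lt_top (μ : Measure E) [μ.IsAddHaarMeasure]
    {u : E → F} (hu : ContDiff ℝ 1 u) {p p' : ℝ≥0} (hp : 1 ≤ p) (hn : 0 < finrank ℝ E)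
    (hp' : (p' : ℝ)⁻¹ = (p : ℝ)⁻¹ - (finrank ℝ E : ℝ)⁻¹) (hup : eLpNorm u p μ < ∞) :
    eLpNorm u p' μ ≤ SNormLESNormFDerivOfEqConst F μ p * eLpNorm (fderiv ℝ u) p μ := by
  obtain ⟨C, hC0, hC⟩ := exists_norm_fderiv_cutoff_le (E := E)
  set K : ℝ≥0 := SNormLESNormFDerivOfEqConst F μ p with hK
  have hp1 : (1 : ℝ≥0∞) ≤ (p : ℝ≥0∞) := by exact_mod_cast hp
  -- the truncations `u_n = χ_{n+1} u`
  set uR : ℕ → E → F := fun n x => cutoff ((n : ℝ) + 1) x • u x with huR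
  have hRpos : ∀ n : ℕ, (0 : ℝ) < n + 1 := fun n => by positivity
  have h1 : ∀ n, ContDiff ℝ 1 (uR n) := fun n => (contDiff_cutoff _).smul hu
  have h2 : ∀ n, HasCompactSupport (uR n) := fun n =>
    (hasCompactSupport_cutoff (hRpos n)).smul_right
  -- GNS for each truncation, and the derivative bound
  have hGNS : ∀ n, eLpNorm (uR n) p' μ ≤
      K * (eLpNorm (fderiv ℝ u) p μ + ENNReal.ofReal (C / (n + 1)) * eLpNorm u p μ) := fun n =>
    (eLpNorm_le_eLpNorm_fderiv_of_eq μ (h1 n) (h2 n) hp hn hp').trans <| by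
      rw [← hK]
      gcongr
      exact eLpNorm_fderiv_cutoff_smul_le μ hu hC0 (hRpos n) (hC _ (hRpos n)) hp1
  -- pointwise convergence `u_n → u` and Fatou in `L^{p'}`
  have hlim : ∀ x, Tendsto (fun n => uR n x) atTop (𝓝 (u x)) := fun x => by
    have := (tendsto_cutoff_natCast_add_one x).smul_const (u x)
    simpa [huR] using this
  have hFatou : eLpNorm u p' μ ≤ atTop.liminf fun n => eLpNorm (uR n) p' μ :=
    Lp.eLpNorm_lim_le_liminf_eLpNorm (fun n => (h1 n).continuous.aestronglyMeasurable) u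
      (Eventually.of_forall hlim)
  -- the right-hand sides converge to `K ‖Du‖_p`
  have hcoef : Tendsto (fun n : ℕ => ENNReal.ofReal (C / (n + 1))) atTop (𝓝 0) := by
    rw [← ENNReal.ofReal_zero]
    exact ENNReal.tendsto_ofReal
      (tendsto_const_nhds.div_atTop (tendsto_natCast_atTop_atTop.atTop_add tendsto_const_nhds))
  have hrhs : Tendsto (fun n : ℕ =>
      (K : ℝ≥0∞) * (eLpNorm (fderiv ℝ u) p μ + ENNReal.ofReal (C / (n + 1)) * eLpNorm u p μ))
      atTop (𝓝 ((K : ℝ≥0∞) * (eLpNorm (fderiv ℝ u) p μ + 0 * eLpNorm u p μ))) := by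
    refine ENNReal.Tendsto.const_mul (tendsto_const_nhds.add ?_) (Or.inr ENNReal.coe_ne_top)
    exact ENNReal.Tendsto.mul_const hcoef (Or.inr hup.ne)
  calc eLpNorm u p' μ ≤ atTop.liminf fun n => eLpNorm (uR n) p' μ := hFatou
    _ ≤ atTop.liminf fun n : ℕ =>
        (K : ℝ≥0∞) * (eLpNorm (fderiv ℝ u) p μ + ENNReal.ofReal (C / (n + 1)) * eLpNorm u p μ) :=
        liminf_le_liminf (Eventually.of_forall hGNS)
    _ = (K : ℝ≥0∞) * (eLpNorm (fderiv ℝ u) p μ + 0 * eLpNorm u p μ) := hrhs.liminf_eq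
    _ = K * eLpNorm (fderiv ℝ u) p μ := by rw [zero_mul, add_zero]

/-- **`H¹(ℝ³) ⊂ L⁶(ℝ³)` for smooth fields.** On a `3`-dimensional real inner product space `E`
with an additive Haar measure `μ`: for every `C¹` map `u : E → F` with `u ∈ L²(μ)`,
`‖u‖_{L⁶(μ)} ≤ K ‖Du‖_{L²(μ)}`, `K = SNormLESNormFDerivOfEqConst F μ 2` (the case `n = 3`, `p = 2`,
`p' = 6` of `eLpNorm_le_eLpNorm_fderiv_of_eq_of_eLpNorm_lt_top`; Evans, *PDE*, §5.6.1, and the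
embedding `Ḣ¹(ℝ³) ⊂ L⁶(ℝ³)` used in Tao 2011, §2, §5). [cite: Evans2010, §5.6.1 Thm. 1–2] -/
theorem eLpNorm_six_le_eLpNorm_fderiv_two (μ : Measure E) [μ.IsAddHaarMeasure]
    (hE : finrank ℝ E = 3) {u : E → F} (hu : ContDiff ℝ 1 u) (hup : eLpNorm u 2 μ < ∞) :
    eLpNorm u 6 μ ≤ SNormLESNormFDerivOfEqConst F μ 2 * eLpNorm (fderiv ℝ u) 2 μ := by
  have h := eLpNorm_le_eLpNorm_fderiv_of_eq_of_eLpNorm_lt_top μ hu (p := 2) (p' := 6)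
    one_le_two (by omega) (by rw [hE]; norm_num) (by exact_mod_cast hup)
  exact_mod_cast h

/-! ## Gagliardo–Nirenberg interpolation in dimension three: the `L⁴` and `L³` inequalities in
integral form (APPENDED 2026-08-27)

On a three-dimensional space the whole-space inequality `‖u‖_{L⁶} ≤ K‖Du‖_{L²}` above
(`eLpNorm_six_le_eLpNorm_fderiv_two`, `K = SNormLESNormFDerivOfEqConst F μ 2`) and Hölder's inequality
give, for `C¹` fields with the relevant powers of `‖u‖` integrable (e.g. rapidly decaying fields — no
compact support), the two interpolation inequalities used verbatim by the Navier–Stokes energy /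
enstrophy literature (Evans, *PDE*, §5.6.1 Thm. 1–2 for the embedding; the interpolation step is
Hölder): `∫‖u‖⁴ ≤ K³ (∫‖u‖²)^{1/2} (∫‖Du‖²)^{3/2}` (i.e. `‖u‖_{L⁴} ≤ K^{3/4}‖u‖₂^{1/4}‖Du‖₂^{3/4}`,
Ladyzhenskaya's inequality in 3D) and `∫‖u‖³ ≤ K^{3/2} (∫‖u‖²)^{3/4} (∫‖Du‖²)^{3/4}`
(`‖u‖_{L³} ≤ K^{1/2}‖u‖₂^{1/2}‖Du‖₂^{1/2}`). `lean search`: no prior whole-space `L³`/`L⁴` interpolation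
without compact support in Mathlib or the tree (`CutoffSobolevInterpolation.integral_pow_four_le` is the
`C_c` real-valued form). -/

section Interpolation3D

variable (μ : Measure E) [μ.IsAddHaarMeasure]

omit [InnerProductSpace ℝ E] [FiniteDimensional ℝ E] [NormedSpace ℝ F] [FiniteDimensional ℝ F]
  [μ.IsAddHaarMeasure] in
/-- Cauchy–Schwarz interpolation of powers of `‖u‖`: `∫‖u‖^{a+b} ≤ √(∫‖u‖^{2a}) √(∫‖u‖^{2b})` for a
continuous field with `‖u‖^{2a}, ‖u‖^{2b} ∈ L¹`. (Proof device.) [folklore] -/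
private theorem integral_norm_pow_add_le {u : E → F} (hu : Continuous u) (a b : ℕ)
    (ha : Integrable (fun x => ‖u x‖ ^ (2 * a)) μ) (hb : Integrable (fun x => ‖u x‖ ^ (2 * b)) μ) :
    ∫ x, ‖u x‖ ^ (a + b) ∂μ ≤
      Real.sqrt (∫ x, ‖u x‖ ^ (2 * a) ∂μ) * Real.sqrt (∫ x, ‖u x‖ ^ (2 * b) ∂μ) := by
  have hmem : ∀ c : ℕ, Integrable (fun x => ‖u x‖ ^ (2 * c)) μ →
      MemLp (fun x => ‖u x‖ ^ c) (ENNReal.ofReal 2) μ := by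
    intro c hc
    rw [ENNReal.ofReal_ofNat]
    refine (memLp_two_iff_integrable_sq_norm ((hu.norm.pow c).aestronglyMeasurable)).2 ?_
    refine hc.congr (ae_of_all _ fun x => ?_)
    show ‖u x‖ ^ (2 * c) = ‖‖u x‖ ^ c‖ ^ 2
    rw [norm_pow, norm_norm, ← pow_mul, mul_comm]
  have h := integral_mul_norm_le_Lp_mul_Lq Real.HolderConjugate.two_two (hmem a ha) (hmem b hb)
  have e1 : ∫ x, ‖‖u x‖ ^ a‖ * ‖‖u x‖ ^ b‖ ∂μ = ∫ x, ‖u x‖ ^ (a + b) ∂μ :=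
    integral_congr_ae (ae_of_all _ fun x => by
      show ‖‖u x‖ ^ a‖ * ‖‖u x‖ ^ b‖ = ‖u x‖ ^ (a + b)
      rw [norm_pow, norm_norm, norm_pow, norm_norm, pow_add])
  have e2 : ∀ c : ℕ, ∫ x, ‖‖u x‖ ^ c‖ ^ (2 : ℝ) ∂μ = ∫ x, ‖u x‖ ^ (2 * c) ∂μ := fun c =>
    integral_congr_ae (ae_of_all _ fun x => by
      show ‖‖u x‖ ^ c‖ ^ (2 : ℝ) = ‖u x‖ ^ (2 * c)
      rw [norm_pow, norm_norm, Real.rpow_two, ← pow_mul, mul_comm])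
  rw [e1, e2 a, e2 b, ← Real.sqrt_eq_rpow, ← Real.sqrt_eq_rpow] at h
  exact h

/-- The whole-space inequality `H¹ ⊂ L⁶` in INTEGRAL form, dimension three: for `u ∈ C¹` with
`‖u‖², ‖u‖⁶, ‖Du‖² ∈ L¹`, `∫‖u‖⁶ ≤ (K √∫‖Du‖²)⁶`. [cite: Evans2010, §5.6.1 Thm. 1–2] -/
theorem integral_norm_pow_six_le_of_integrable (hE : finrank ℝ E = 3) {u : E → F}
    (hu : ContDiff ℝ 1 u) (h2 : Integrable (fun x => ‖u x‖ ^ 2) μ)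
    (h6 : Integrable (fun x => ‖u x‖ ^ 6) μ) (hD : Integrable (fun x => ‖fderiv ℝ u x‖ ^ 2) μ) :
    ∫ x, ‖u x‖ ^ 6 ∂μ ≤
      ((SNormLESNormFDerivOfEqConst F μ 2 : ℝ) * Real.sqrt (∫ x, ‖fderiv ℝ u x‖ ^ 2 ∂μ)) ^ 6 := by
  set K₀ : NNReal := SNormLESNormFDerivOfEqConst F μ 2 with hK₀
  have huc : Continuous u := hu.continuous
  have hDc : Continuous (fderiv ℝ u) := hu.continuous_fderiv one_ne_zero
  have hm2 : MemLp u 2 μ := (memLp_two_iff_integrable_sq_norm huc.aestronglyMeasurable).2 h2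
  have hm6 : MemLp u 6 μ := by
    refine (integrable_norm_rpow_iff huc.aestronglyMeasurable (by norm_num) (by norm_num)).1 ?_
    refine h6.congr (ae_of_all _ fun x => ?_)
    simp only [ENNReal.toReal_ofNat]
    rw [show (6 : ℝ) = ((6 : ℕ) : ℝ) by norm_num, Real.rpow_natCast]
  have hmD : MemLp (fderiv ℝ u) 2 μ := (memLp_two_iff_integrable_sq_norm hDc.aestronglyMeasurable).2 hD
  have hsob := eLpNorm_six_le_eLpNorm_fderiv_two μ hE hu hm2.eLpNorm_lt_top
  set I6 : ℝ := ∫ x, ‖u x‖ ^ 6 ∂μ with hI6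
  set B : ℝ := ∫ x, ‖fderiv ℝ u x‖ ^ 2 ∂μ with hB
  have hI60 : 0 ≤ I6 := integral_nonneg fun x => by positivity
  have e6 : eLpNorm u 6 μ = ENNReal.ofReal (I6 ^ ((6 : ℝ)⁻¹)) := by
    rw [MemLp.eLpNorm_eq_integral_rpow_norm (by norm_num) (by norm_num) hm6, ENNReal.toReal_ofNat]
    have hint : ∫ x, ‖u x‖ ^ (6 : ℝ) ∂μ = I6 := integral_congr_ae (ae_of_all _ fun x => by
      show ‖u x‖ ^ (6 : ℝ) = ‖u x‖ ^ 6
      rw [show (6 : ℝ) = ((6 : ℕ) : ℝ) by norm_num, Real.rpow_natCast])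
    simp only [hint]
  have e2 : eLpNorm (fderiv ℝ u) 2 μ = ENNReal.ofReal (Real.sqrt B) := by
    rw [MemLp.eLpNorm_eq_integral_rpow_norm (by norm_num) (by norm_num) hmD, ENNReal.toReal_ofNat]
    have hint : ∫ x, ‖fderiv ℝ u x‖ ^ (2 : ℝ) ∂μ = B := integral_congr_ae (ae_of_all _ fun x => by
      show ‖fderiv ℝ u x‖ ^ (2 : ℝ) = ‖fderiv ℝ u x‖ ^ 2
      rw [Real.rpow_two])
    rw [hint, Real.sqrt_eq_rpow, one_div]
  rw [e6, e2, ← ENNReal.ofReal_coe_nnreal, ← ENNReal.ofReal_mul (NNReal.coe_nonneg _)] at hsob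
  have hle : I6 ^ ((6 : ℝ)⁻¹) ≤ (K₀ : ℝ) * Real.sqrt B :=
    (ENNReal.ofReal_le_ofReal_iff (by positivity)).1 hsob
  have h := pow_le_pow_left₀ (Real.rpow_nonneg hI60 _) hle 6
  have hid : (I6 ^ ((6 : ℝ)⁻¹)) ^ (6 : ℕ) = I6 := by
    rw [← Real.rpow_natCast, ← Real.rpow_mul hI60]; norm_num
  rwa [hid] at h

/-- **The `L⁴` Gagliardo–Nirenberg (Ladyzhenskaya) inequality on a three-dimensional space, integral
form, no compact support**: for `u ∈ C¹` with `‖u‖², ‖u‖⁶, ‖Du‖² ∈ L¹`,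
`∫‖u‖⁴ ≤ K³ (∫‖u‖²)^{1/2} (∫‖Du‖²)^{3/2}` — i.e. `‖u‖_{L⁴} ≤ K^{3/4}‖u‖_{L²}^{1/4}‖Du‖_{L²}^{3/4}` — with
Mathlib's Gagliardo–Nirenberg–Sobolev constant `K` (Sobolev embedding + the Cauchy–Schwarz interpolation
`∫‖u‖⁴ ≤ √∫‖u‖² √∫‖u‖⁶`). [cite: Evans2010, §5.6.1 Thm. 1–2] -/
theorem integral_norm_pow_four_le_of_integrable (hE : finrank ℝ E = 3) {u : E → F}
    (hu : ContDiff ℝ 1 u) (h2 : Integrable (fun x => ‖u x‖ ^ 2) μ)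
    (h6 : Integrable (fun x => ‖u x‖ ^ 6) μ) (hD : Integrable (fun x => ‖fderiv ℝ u x‖ ^ 2) μ) :
    ∫ x, ‖u x‖ ^ 4 ∂μ ≤
      (SNormLESNormFDerivOfEqConst F μ 2 : ℝ) ^ 3 * (∫ x, ‖u x‖ ^ 2 ∂μ) ^ (1 / 2 : ℝ) *
        (∫ x, ‖fderiv ℝ u x‖ ^ 2 ∂μ) ^ (3 / 2 : ℝ) := by
  set K : ℝ := (SNormLESNormFDerivOfEqConst F μ 2 : ℝ) with hK
  set A : ℝ := ∫ x, ‖u x‖ ^ 2 ∂μ with hA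
  set B : ℝ := ∫ x, ‖fderiv ℝ u x‖ ^ 2 ∂μ with hB
  set I6 : ℝ := ∫ x, ‖u x‖ ^ 6 ∂μ with hI6
  have hB0 : 0 ≤ B := integral_nonneg fun x => by positivity
  have h4 := integral_norm_pow_add_le μ hu.continuous 1 3 (by simpa using h2) (by simpa using h6)
  norm_num at h4
  have hs6 : Real.sqrt I6 ≤ (K * Real.sqrt B) ^ 3 := by
    have h6' := integral_norm_pow_six_le_of_integrable μ hE hu h2 h6 hD
    have := Real.sqrt_le_sqrt (h6'.trans_eq (by ring : (K * Real.sqrt B) ^ 6 = ((K * Real.sqrt B) ^ 3) ^ 2))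
    rwa [Real.sqrt_sq (by positivity)] at this
  have hA12 : A ^ (1 / 2 : ℝ) = Real.sqrt A := by rw [Real.sqrt_eq_rpow]
  have hB32 : B ^ (3 / 2 : ℝ) = Real.sqrt B ^ 3 := by
    rw [Real.sqrt_eq_rpow, ← Real.rpow_natCast, ← Real.rpow_mul hB0]; norm_num
  calc ∫ x, ‖u x‖ ^ 4 ∂μ ≤ Real.sqrt A * Real.sqrt I6 := h4
    _ ≤ Real.sqrt A * (K * Real.sqrt B) ^ 3 := mul_le_mul_of_nonneg_left hs6 (Real.sqrt_nonneg _)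
    _ = K ^ 3 * Real.sqrt A * Real.sqrt B ^ 3 := by ring
    _ = K ^ 3 * A ^ (1 / 2 : ℝ) * B ^ (3 / 2 : ℝ) := by rw [hA12, hB32]

/-- **The `L³` Gagliardo–Nirenberg inequality on a three-dimensional space, integral form, no
compact support**: for `u ∈ C¹` with `‖u‖², ‖u‖⁴, ‖u‖⁶, ‖Du‖² ∈ L¹`,
`∫‖u‖³ ≤ K^{3/2} (∫‖u‖²)^{3/4} (∫‖Du‖²)^{3/4}` — i.e. `‖u‖_{L³} ≤ K^{1/2}‖u‖_{L²}^{1/2}‖Du‖_{L²}^{1/2}`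
(Sobolev embedding + two Cauchy–Schwarz interpolations `∫‖u‖³ ≤ √∫‖u‖² √∫‖u‖⁴`,
`∫‖u‖⁴ ≤ √∫‖u‖² √∫‖u‖⁶`). [cite: Evans2010, §5.6.1 Thm. 1–2] -/
theorem integral_norm_pow_three_le_of_integrable (hE : finrank ℝ E = 3) {u : E → F}
    (hu : ContDiff ℝ 1 u) (h2 : Integrable (fun x => ‖u x‖ ^ 2) μ)
    (h4 : Integrable (fun x => ‖u x‖ ^ 4) μ) (h6 : Integrable (fun x => ‖u x‖ ^ 6) μ)
    (hD : Integrable (fun x => ‖fderiv ℝ u x‖ ^ 2) μ) :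
    ∫ x, ‖u x‖ ^ 3 ∂μ ≤
      (SNormLESNormFDerivOfEqConst F μ 2 : ℝ) ^ (3 / 2 : ℝ) * (∫ x, ‖u x‖ ^ 2 ∂μ) ^ (3 / 4 : ℝ) *
        (∫ x, ‖fderiv ℝ u x‖ ^ 2 ∂μ) ^ (3 / 4 : ℝ) := by
  set K : ℝ := (SNormLESNormFDerivOfEqConst F μ 2 : ℝ) with hK
  have hK0 : 0 ≤ K := NNReal.coe_nonneg _
  set A : ℝ := ∫ x, ‖u x‖ ^ 2 ∂μ with hA
  set B : ℝ := ∫ x, ‖fderiv ℝ u x‖ ^ 2 ∂μ with hB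
  set I4 : ℝ := ∫ x, ‖u x‖ ^ 4 ∂μ with hI4
  set I6 : ℝ := ∫ x, ‖u x‖ ^ 6 ∂μ with hI6
  have hA0 : 0 ≤ A := integral_nonneg fun x => by positivity
  have hB0 : 0 ≤ B := integral_nonneg fun x => by positivity
  have h4' := integral_norm_pow_add_le μ hu.continuous 1 3 (by simpa using h2) (by simpa using h6)
  have h3' := integral_norm_pow_add_le μ hu.continuous 1 2 (by simpa using h2) (by simpa using h4)
  norm_num at h4' h3'
  have h6' := integral_norm_pow_six_le_of_integrable μ hE hu h2 h6 hD
  simp only [← hK, ← hA, ← hB, ← hI4, ← hI6] at h4' h3' h6'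
  -- fourth roots `a, b` and `k = √K`: `A = a⁴`, `B = b⁴`, `K = k²`
  set a := Real.sqrt (Real.sqrt A) with ha
  set b := Real.sqrt (Real.sqrt B) with hb
  set k := Real.sqrt K with hk
  have ha0 : 0 ≤ a := Real.sqrt_nonneg _
  have hb0 : 0 ≤ b := Real.sqrt_nonneg _
  have hk0 : 0 ≤ k := Real.sqrt_nonneg _
  have hsA : Real.sqrt A = a ^ 2 := (Real.sq_sqrt (Real.sqrt_nonneg A)).symm
  have hsB : Real.sqrt B = b ^ 2 := (Real.sq_sqrt (Real.sqrt_nonneg B)).symm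
  have hAa : A = a ^ 4 := by rw [show a ^ 4 = (a ^ 2) ^ 2 by ring, ← hsA, Real.sq_sqrt hA0]
  have hBb : B = b ^ 4 := by rw [show b ^ 4 = (b ^ 2) ^ 2 by ring, ← hsB, Real.sq_sqrt hB0]
  have hKk : K = k ^ 2 := (Real.sq_sqrt hK0).symm
  have hA34 : A ^ (3 / 4 : ℝ) = a ^ 3 := by
    rw [hAa, ← Real.rpow_natCast a 4, ← Real.rpow_mul ha0,
      show ((4 : ℕ) : ℝ) * (3 / 4 : ℝ) = ((3 : ℕ) : ℝ) by norm_num, Real.rpow_natCast]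
  have hB34 : B ^ (3 / 4 : ℝ) = b ^ 3 := by
    rw [hBb, ← Real.rpow_natCast b 4, ← Real.rpow_mul hb0,
      show ((4 : ℕ) : ℝ) * (3 / 4 : ℝ) = ((3 : ℕ) : ℝ) by norm_num, Real.rpow_natCast]
  have hK32 : K ^ (3 / 2 : ℝ) = k ^ 3 := by
    rw [hKk, ← Real.rpow_natCast k 2, ← Real.rpow_mul hk0,
      show ((2 : ℕ) : ℝ) * (3 / 2 : ℝ) = ((3 : ℕ) : ℝ) by norm_num, Real.rpow_natCast]
  have hs6 : Real.sqrt I6 ≤ (k * b) ^ 6 := by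
    have h6'' : I6 ≤ ((k * b) ^ 6) ^ 2 := h6'.trans_eq (by rw [hKk, hsB]; ring)
    have := Real.sqrt_le_sqrt h6''
    rwa [Real.sqrt_sq (by positivity)] at this
  have hs4 : Real.sqrt I4 ≤ a * (k * b) ^ 3 := by
    have h4'' : I4 ≤ (a * (k * b) ^ 3) ^ 2 :=
      calc I4 ≤ Real.sqrt A * Real.sqrt I6 := h4'
        _ ≤ a ^ 2 * (k * b) ^ 6 := by rw [hsA]; exact mul_le_mul_of_nonneg_left hs6 (by positivity)
        _ = (a * (k * b) ^ 3) ^ 2 := by ring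
    have := Real.sqrt_le_sqrt h4''
    rwa [Real.sqrt_sq (by positivity)] at this
  calc ∫ x, ‖u x‖ ^ 3 ∂μ ≤ Real.sqrt A * Real.sqrt I4 := h3'
    _ ≤ a ^ 2 * (a * (k * b) ^ 3) := by rw [hsA]; exact mul_le_mul_of_nonneg_left hs4 (by positivity)
    _ = k ^ 3 * a ^ 3 * b ^ 3 := by ring
    _ = K ^ (3 / 2 : ℝ) * A ^ (3 / 4 : ℝ) * B ^ (3 / 4 : ℝ) := by rw [hK32, hA34, hB34]

end Interpolation3D

end Literature.Analysis.FluidPDE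

end
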